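import Literature.MathematicalPhysics.QuantumFieldTheory.Balaban1983to89.B9Thm313WholeL2G
import Literature.MathematicalPhysics.QuantumFieldTheory.Balaban1983to89.B9Thm312WholeBlocksNbr

/-!
# `Balaban1983to89.B9Thm313WholeL2GP` — [B9] Theorem 3.13 (p. 426): the SECOND-ORDER block-L² lines (3.46)₃,₅ of the propagator 𝔊 = 𝔓G₁ = G₁𝔓*
# at one member and one configuration, PRINT-FAITHFULLY as the DIRECTION-PAIR families ∇_{U,ν}∇_{U,μ}𝔊 and 𝔊∇\*_{U,ν}∇\*_{U,μ} — the pair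
# twins of `…B9Thm313WholeL2G.GG_l2bd_entry3∕5` and of its letter schema

T. Bałaban, *Propagators for lattice gauge theories in a background field*, Commun. Math. Phys. **99** (1985) 389–434
[`Balaban1985BackgroundPropagators`, "B9"]; [4] = T. Bałaban, *Propagators and renormalization transformations for lattice
gauge theories. II*, Commun. Math. Phys. **96** (1984) 223–250 [`Balaban1984PropagatorsII`].

statement-level skeleton of published theorems with citation tags; proofs where landed; nothing here is a claim about the
Yang–Mills mass gap

THE PRINTED LOCI (verbatim).  Theorem 3.13 p. 426: *"If an external gauge field configuration U satisfies the regularity conditions (3.35), (3.36)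
for α₀ sufficiently small, then Theorems 3.3, 3.10, 3.11 hold for the propagator 𝔊, with the exception of the inequality in (3.42) involving the
covariant Laplace operator"*; p. 426: *"The formulas (3.147), (3.153) permit us to reduce properties of the operators 𝔓, 𝔊 to the corresponding
properties of the operators G′, (Q′G′²Q′*)⁻¹, G₁, (QG₁Q*)⁻¹"*; (3.153) p. 426; (3.46) p. 398 ll. 19–22 (lit-balaban desk reading): the second-order
members are ‖h∇_U∇_UG′λ‖, ‖h∇_UG′∇\*_Uλ‖, ‖hG′∇\*_U∇\*_Uλ‖; (3.39) p. 397 *"max_{μ,ν}"*; p. 398 ll. 28–31 (∇ ∕ ∇* and the scale powers are conventional;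
[4] Lemma 2.1 transfers (Lʲη)^α to (Lʲη)^β(L^{j′}η)^γ); Theorem 3.12 p. 423; [4] (2.51)–(2.52) p. 232, Lemma 2.1 p. 234.

WHY THIS FILE (the row-21 twin of `…B9Thm312WholeBlocksNbr` §2, same seat).  `…B9Thm313WholeL2G` models the weight-1 lines n = 3, 5 of (3.46) for
𝔊 by the Laplacian composites Δ_U𝔊, 𝔊Δ_U (letter `Lap`), which are trace consequences and not the printed members, and which the record's
kernel family `Node00.kernelFamilyB.l2 3∕5` (sup over direction PAIRS) cannot read (n06-k's located point (O3), desk answer of record).  THIS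
FILE supplies the print-faithful layer:
* §1 the letter schema ★ `Letters313L2P 𝔬 Dd Dds …` — `Letters313L2` with its three Laplacian fields replaced by the PER-PAIR fields `ddGDv q`
  (∇_ν∇_μG₀D), `ddGQs q` (∇_ν∇_μG₀Q*), `rgdDds q` (RD*G₁∇\*_ν∇\*_μ), the direction letters `Dd Dds : B.Cfg → P → Module.End ℝ (X → ℝ)` shared with
  row 20's `Thm33G0L2P`; its projection `Letters313L2P.toLap` onto `Letters313L2 𝔬 (fun _ => 0) …` (the Laplacian-free fields, for the
  sibling's `GG_l2bd_entry4`), and the rate weakenings `letters313L2P_mono`, `thm33G0L2P_mono`.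
* §2 ★ `GG_l2bd_left` ∕ ★ `GG_l2bd_right` — `GG_l2bd_entry3∕5` with the Laplacian replaced by a GENERIC left letter E : 𝔩(X) → 𝔩(X₃) ∕ right
  letter F : 𝔩(X₀) → 𝔩(X) and the E∕F-specific bounds as explicit hypotheses (the G₁-entries by r1-g6's Neumann bookkeeping
  `entry_l2w_of_step`, (3.153) by `E_GG_eq` ∕ `GG_comp_eq` and `hasMaj_frakG_classes`, the p. 398 transfer by `blockBd_transfer`).
* §3 ★ `GG_l2bd_family3` ∕ ★ `GG_l2bd_family5` — the pair families ∇_ν∇_μ𝔊, 𝔊∇\*_ν∇\*_μ packaged by n06-k's `familyOp` over P × P as ONE model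
  X → X × (P × P) with block map `blk ∘ Prod.fst` (constant √|P × P|·K·Λ), the shape of the `L2ReadsNbr … 3∕5` binders of rows 18–21.

HONEST SCOPE.  Nothing of [B9] or [4] is asserted: Theorem 3.3 for G₀, the step, the letters and the member facts are HYPOTHESES of printed ∕
definitional shape; the content is p. 426's reduction sentence carried out in the block-L² classes, kernel-checked.  NOT a node discharge, NOT
summit progress; one finite lattice at a time; nothing continuum, nothing about the mass gap.  Cell `pub-ymgap` (HUMAN RULING D-0062), Track A
node N06 [B9], N06-ASSIGNMENT v1 row 21 (bundle F7), seat `pub-ymgap-dag-n06-l` (g5), 2026-08-27.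
-/

namespace Literature.MathematicalPhysics.QuantumFieldTheory.Balaban1983to89.B9Thm313WholeL2GP

open Literature.MathematicalPhysics.QuantumFieldTheory.Balaban1983to89
open Finset B6RandomWalk B6RandomWalkHom B9Thm34Ext B9Thm37GlueCor36 B11SectG B9SectDSup B9SectDL2Decay
open B9Thm37AllNorms B9Thm37AllNormsInstances B9Thm312Whole B9Thm312WholeLeaf B9Thm312WholeLeft B9Thm313Whole B9Thm313WholeLeft
open B9Ineq347 B9Thm312WholeClasses B9Thm312WholeL2 B9Thm313WholeHolder B9Thm313WholeL2G B9Thm312WholeBlocksNbr B9RWSums346SecondDiff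

noncomputable section

section L2GP

variable {g : B9.Geometry} {B : B9.Backgrounds} {X Y Z W P : Type} [Fintype X] [Fintype Y] [Fintype Z] [Fintype W]
  [Fintype g.Site]
variable {R₀ : ℝ} {H₀ : Prop}

/-! ## §1 The block-L² letters of (3.152)–(3.153) with the second-order pieces per direction pair -/

/-- ★ **THE BLOCK-L² LETTERS OF THEOREM 3.13's REDUCTION AT U, SECOND-ORDER PIECES PER DIRECTION PAIR** (p. 426) — `B9Thm313WholeL2G.Letters313L2`
with its three Laplacian fields replaced by the families over the pairs q = (ν, μ) ∈ P × P: `gDv`, `dGDv`, `gQs`, `dGQs`, `rgdI`, `rgdDs`, `c1`, `q`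
verbatim; `ddGDv q` — ∇_{U,ν}∇_{U,μ}G₀D (factor (Lʲη)⁻¹); `ddGQs q` — ∇_{U,ν}∇_{U,μ}G₀Q* (factor L^{j′}η∕Lʲη); `rgdDds q` — RD*G₁∇\*_{U,ν}∇\*_{U,μ}
((3.152); factor (L^{j′}η)⁻¹).  NOTHING ASSERTED: these are the instance's (Theorem 3.1, (3.49), (3.126), (3.132), (3.152)).
[cite: Balaban1985BackgroundPropagators, Thm 3.13 p.426 + (3.152)–(3.153) p.426 + (3.132) p.422 + (3.126) p.420 + (3.46) p.398 + (3.39) p.397 + p.398 (remark after (3.47)); Balaban1984PropagatorsII, (2.26) p.228] -/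
structure Letters313L2P (𝔬 : Ops g B X Y Z W) (Dd Dds : B.Cfg → P → Module.End ℝ (X → ℝ)) (R₀ : ℝ) (H₀ : Prop) (B₄ δ : ℝ)
    (U : B.Cfg) : Prop where
  gDv : BlockBd (g := toB6 g R₀ H₀) 𝔬.blkW 𝔬.blk (𝔬.G0 U ∘ₗ 𝔬.Dv U)
    (fun (y y' : g.Site) => B₄ * g.len y * Real.exp (-(δ * g.dist y y')))
  ddGDv : ∀ q : P × P, BlockBd (g := toB6 g R₀ H₀) 𝔬.blkW 𝔬.blk ((Dd U q.1 ∘ₗ Dd U q.2) ∘ₗ 𝔬.G0 U ∘ₗ 𝔬.Dv U)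
    (fun (y y' : g.Site) => B₄ * (g.len y)⁻¹ * Real.exp (-(δ * g.dist y y')))
  dGDv : BlockBd (g := toB6 g R₀ H₀) 𝔬.blkW 𝔬.blkY (𝔬.D U ∘ₗ 𝔬.G0 U ∘ₗ 𝔬.Dv U)
    (fun (y y' : g.Site) => B₄ * Real.exp (-(δ * g.dist y y')))
  gQs : BlockBd (g := toB6 g R₀ H₀) 𝔬.blkZ 𝔬.blk (𝔬.G0 U ∘ₗ 𝔬.Qstar U)
    (fun (y y' : g.Site) => B₄ * g.len y * g.len y' * Real.exp (-(δ * g.dist y y')))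
  ddGQs : ∀ q : P × P, BlockBd (g := toB6 g R₀ H₀) 𝔬.blkZ 𝔬.blk ((Dd U q.1 ∘ₗ Dd U q.2) ∘ₗ 𝔬.G0 U ∘ₗ 𝔬.Qstar U)
    (fun (y y' : g.Site) => B₄ * ((g.len y)⁻¹ * g.len y') * Real.exp (-(δ * g.dist y y')))
  dGQs : BlockBd (g := toB6 g R₀ H₀) 𝔬.blkZ 𝔬.blkY (𝔬.D U ∘ₗ 𝔬.G0 U ∘ₗ 𝔬.Qstar U)
    (fun (y y' : g.Site) => B₄ * g.len y' * Real.exp (-(δ * g.dist y y')))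
  rgdI : BlockBd (g := toB6 g R₀ H₀) 𝔬.blk 𝔬.blkW (𝔬.R U ∘ₗ 𝔬.Dvstar U ∘ₗ 𝔬.G1 U ∘ₗ LinearMap.id)
    (fun (y y' : g.Site) => B₄ * g.len y' * Real.exp (-(δ * g.dist y y')))
  rgdDs : BlockBd (g := toB6 g R₀ H₀) 𝔬.blkY 𝔬.blkW (𝔬.R U ∘ₗ 𝔬.Dvstar U ∘ₗ 𝔬.G1 U ∘ₗ 𝔬.Dstar U)
    (fun (y y' : g.Site) => B₄ * Real.exp (-(δ * g.dist y y')))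
  rgdDds : ∀ q : P × P, BlockBd (g := toB6 g R₀ H₀) 𝔬.blk 𝔬.blkW (𝔬.R U ∘ₗ 𝔬.Dvstar U ∘ₗ 𝔬.G1 U ∘ₗ (Dds U q.1 ∘ₗ Dds U q.2))
    (fun (y y' : g.Site) => B₄ * (g.len y')⁻¹ * Real.exp (-(δ * g.dist y y')))
  c1 : BlockBd (g := toB6 g R₀ H₀) 𝔬.blkZ 𝔬.blkZ (𝔬.C1 U)
    (fun (y y' : g.Site) => B₄ * (g.len y)⁻¹ * (g.len y')⁻¹ * Real.exp (-(δ * g.dist y y')))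
  q : BlockBd (g := toB6 g R₀ H₀) 𝔬.blk 𝔬.blkZ (𝔬.Q U)
    (fun (y y' : g.Site) => B₄ * (g.len y * (g.len y')⁻¹) * Real.exp (-(δ * g.dist y y')))

/-- the Laplacian-free letters as a `Letters313L2` record at the ZERO Laplacian letter (its three Laplacian fields hold trivially), for the
sibling lemmas that read only those (`GG_l2bd_entry4`). [cite: Balaban1985BackgroundPropagators, (3.46) p.398 (bookkeeping)] -/
theorem Letters313L2P.toLap {𝔬 : Ops g B X Y Z W} {Dd Dds : B.Cfg → P → Module.End ℝ (X → ℝ)} {B₄ δ : ℝ} {U : B.Cfg}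
    (hB₄ : 0 ≤ B₄) (hlen : ∀ y : g.Site, 0 ≤ g.len y) (h : Letters313L2P 𝔬 Dd Dds R₀ H₀ B₄ δ U) :
    Letters313L2 𝔬 (fun _ => (0 : Module.End ℝ (X → ℝ))) R₀ H₀ B₄ δ U := by
  have hz : ∀ {V V' : Type} [Fintype V] [Fintype V'] (bv : V → g.Site) (bv' : V' → g.Site) (K : g.Site → g.Site → ℝ),
      (∀ a b, 0 ≤ K a b) → BlockBd (g := toB6 g R₀ H₀) bv bv' (0 : (V → ℝ) →ₗ[ℝ] (V' → ℝ)) K := by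
    intro V V' _ _ bv bv' K hK y' μ _ y
    rw [LinearMap.zero_apply, bl2_zero]
    exact mul_nonneg (hK y y') (bl2_nonneg _ _ _)
  have hli : ∀ y : g.Site, 0 ≤ (g.len y)⁻¹ := fun y => inv_nonneg.mpr (hlen y)
  refine
    { gDv := h.gDv
      dGDv := h.dGDv
      gQs := h.gQs
      dGQs := h.dGQs
      rgdI := h.rgdI
      rgdDs := h.rgdDs
      c1 := h.c1
      q := h.q
      lapGDv := ?_
      lapGQs := ?_
      rgdLap := ?_ }
  · rw [LinearMap.zero_comp]
    exact hz _ _ _ fun a b => mul_nonneg (mul_nonneg hB₄ (hli a)) (Real.exp_nonneg _)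
  · rw [LinearMap.zero_comp]
    exact hz _ _ _ fun a b => mul_nonneg (mul_nonneg hB₄ (mul_nonneg (hli a) (hlen b))) (Real.exp_nonneg _)
  · rw [LinearMap.comp_zero, LinearMap.comp_zero, LinearMap.comp_zero]
    exact hz _ _ _ fun a b => mul_nonneg (mul_nonneg hB₄ (hli b)) (Real.exp_nonneg _)

/-- the pair letters at a slower rate (e^{−δd} ≦ e^{−δ′d} for δ′ ≦ δ, d ≧ 0). [cite: Balaban1985BackgroundPropagators, (3.46) p.398 (bookkeeping)] -/
theorem letters313L2P_mono {𝔬 : Ops g B X Y Z W} {Dd Dds : B.Cfg → P → Module.End ℝ (X → ℝ)} {B₄ δ δ' : ℝ} {U : B.Cfg}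
    (hG : GeoOK g) (hB₄ : 0 ≤ B₄) (hδ : δ' ≤ δ) (h : Letters313L2P 𝔬 Dd Dds R₀ H₀ B₄ δ U) :
    Letters313L2P 𝔬 Dd Dds R₀ H₀ B₄ δ' U := by
  have hexp : ∀ y y' : g.Site, Real.exp (-(δ * g.dist y y')) ≤ Real.exp (-(δ' * g.dist y y')) := fun y y' =>
    Real.exp_le_exp.mpr (neg_le_neg (mul_le_mul_of_nonneg_right hδ (hG.dnn y y')))
  have hl : ∀ y : g.Site, 0 ≤ g.len y := hG.lenle
  have hli : ∀ y : g.Site, 0 ≤ (g.len y)⁻¹ := fun y => inv_nonneg.mpr (hl y)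
  exact
    { gDv := h.gDv.mono fun y y' => mul_le_mul_of_nonneg_left (hexp y y') (mul_nonneg hB₄ (hl y))
      ddGDv := fun q => (h.ddGDv q).mono fun y y' => mul_le_mul_of_nonneg_left (hexp y y') (mul_nonneg hB₄ (hli y))
      dGDv := h.dGDv.mono fun y y' => mul_le_mul_of_nonneg_left (hexp y y') hB₄
      gQs := h.gQs.mono fun y y' => mul_le_mul_of_nonneg_left (hexp y y') (mul_nonneg (mul_nonneg hB₄ (hl y)) (hl y'))
      ddGQs := fun q => (h.ddGQs q).mono fun y y' => mul_le_mul_of_nonneg_left (hexp y y') (mul_nonneg hB₄ (mul_nonneg (hli y) (hl y')))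
      dGQs := h.dGQs.mono fun y y' => mul_le_mul_of_nonneg_left (hexp y y') (mul_nonneg hB₄ (hl y'))
      rgdI := h.rgdI.mono fun y y' => mul_le_mul_of_nonneg_left (hexp y y') (mul_nonneg hB₄ (hl y'))
      rgdDs := h.rgdDs.mono fun y y' => mul_le_mul_of_nonneg_left (hexp y y') hB₄
      rgdDds := fun q => (h.rgdDds q).mono fun y y' => mul_le_mul_of_nonneg_left (hexp y y') (mul_nonneg hB₄ (hli y'))
      c1 := h.c1.mono fun y y' => mul_le_mul_of_nonneg_left (hexp y y') (mul_nonneg (mul_nonneg hB₄ (hli y)) (hli y'))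
      q := h.q.mono fun y y' => mul_le_mul_of_nonneg_left (hexp y y') (mul_nonneg hB₄ (mul_nonneg (hl y) (hli y'))) }

omit [Fintype Z] [Fintype W] in
/-- Rates of the pair L² schema: Theorem 3.3's block-L² bounds at (B₂, δ₁) hold at every smaller rate δ₁′ ≦ δ₁ (B₂ ≧ 0, d ≧ 0) (the pair twin of
`B9Thm312WholeBlocksRel.thm33G0L2_mono`). [cite: Balaban1985BackgroundPropagators, (3.46) p.398 (bookkeeping)] -/
theorem thm33G0L2P_mono {𝔬 : Ops g B X Y Z W} {Dd Dds : B.Cfg → P → Module.End ℝ (X → ℝ)} {B₂ δ₁ δ₁' : ℝ} {U : B.Cfg}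
    (hG : GeoOK g) (hB₂ : 0 ≤ B₂) (hδ : δ₁' ≤ δ₁) (h : Thm33G0L2P 𝔬 Dd Dds R₀ H₀ B₂ δ₁ U) :
    Thm33G0L2P 𝔬 Dd Dds R₀ H₀ B₂ δ₁' U := by
  have hexp : ∀ y y' : g.Site, Real.exp (-(δ₁ * g.dist y y')) ≤ Real.exp (-(δ₁' * g.dist y y')) := fun y y' =>
    Real.exp_le_exp.mpr (neg_le_neg (mul_le_mul_of_nonneg_right hδ (hG.dnn y y')))
  have hl : ∀ y : g.Site, 0 ≤ g.len y := hG.lenle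
  have hli : ∀ y : g.Site, 0 ≤ (g.len y)⁻¹ := fun y => inv_nonneg.mpr (hl y)
  exact
    { l0 := h.l0.mono fun y y' => mul_le_mul_of_nonneg_left (hexp y y') (mul_nonneg (mul_nonneg hB₂ (hl y)) (hl y'))
      l1 := h.l1.mono fun y y' => mul_le_mul_of_nonneg_left (hexp y y') (mul_nonneg hB₂ (hl y'))
      l2 := h.l2.mono fun y y' => mul_le_mul_of_nonneg_left (hexp y y') (mul_nonneg hB₂ (hl y))
      l3 := fun q => (h.l3 q).mono fun y y' => mul_le_mul_of_nonneg_left (hexp y y') (mul_nonneg hB₂ (mul_nonneg (hli y) (hl y')))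
      l4 := h.l4.mono fun y y' => mul_le_mul_of_nonneg_left (hexp y y') hB₂
      l5 := fun q => (h.l5 q).mono fun y y' => mul_le_mul_of_nonneg_left (hexp y y') (mul_nonneg hB₂ (mul_nonneg (hl y) (hli y'))) }

/-! ## §2 The second-order lines of 𝔊 with generic letters -/

/-- ★ **A SECOND-ORDER L² LINE OF 𝔊 = 𝔓G₁ WITH A GENERIC LEFT LETTER** E : 𝔩(X) → 𝔩(X₃) (∇_ν∇_μ, Δ_U, …): (3.153) with the left factor E
(`E_GG_eq`), the G₁-entries EG₁, EG₁D, EG₁Q*, G₁ by r1's Neumann bookkeeping from Theorem 3.3 for G₀ and the step (`entry_l2w_of_step`; the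
E-specific bounds of E∘G₀ (`hE3`, ratio class), E∘G₀D (`hEGDv`), E∘G₀Q* (`hEGQs`) as explicit hypotheses of printed shape), the letters RD*G₁, C₁, Q,
composed by `hasMaj_frakG_classes` in the block-L² classes Lʲη → Lʲη, then the scale transfer (2.60) of p. 398 (`blockBd_transfer`, constant Λ):
block bound `constG46 (constKp B₂ B₄ θ c) c`·Λ·e^{−(ρ−αρ₀)d(y,y′)} between `blk` and `blk₃`; provisos ρ + 5σ ≦ δ, B₂θc² < 1 (the abstraction of
`GG_l2bd_entry3` from Δ_U to any E). [cite: Balaban1985BackgroundPropagators, Thm 3.13 p.426 + (3.153) p.426 + (3.46) p.398 + p.398 (remark after (3.47)); Balaban1984PropagatorsII, Lemma 2.1 (2.60)–(2.61) p.234] -/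
theorem GG_l2bd_left (hG : GeoOK g) {𝔬 : Ops g B X Y Z W} {Lap : B.Cfg → Module.End ℝ (X → ℝ)} {U : B.Cfg}
    {X₃ : Type} [Fintype X₃] {blk₃ : X₃ → g.Site} {E : (X → ℝ) →ₗ[ℝ] (X₃ → ℝ)}
    {B₂ B₄ θ δ ρ ρ₀ α Λ σ c : ℝ} (hrow : RowSum (toB6 g R₀ H₀) σ c) (hB₂ : 0 ≤ B₂) (hB₄ : 0 ≤ B₄) (hθ : 0 ≤ θ) (hρ : 0 ≤ ρ)
    (hσ : 0 ≤ σ) (hρδ : ρ + 5 * σ ≤ δ) (hST : ScaleTransfer g ρ₀ α Λ (fun y => g.len y ^ (1 : ℝ)))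
    (hL : Thm33G0L2 𝔬 Lap R₀ H₀ B₂ δ U)
    (hT : BlockBd (g := toB6 g R₀ H₀) 𝔬.blk 𝔬.blk (𝔬.Tpi U + 𝔬.T2 U)
      (fun (y y' : g.Site) => θ * (g.len y)⁻¹ * (g.len y')⁻¹ * Real.exp (-(δ * g.dist y y'))))
    (hLt : Letters313L2 𝔬 Lap R₀ H₀ B₄ δ U)
    (hE3 : BlockBd (g := toB6 g R₀ H₀) 𝔬.blk blk₃ (E ∘ₗ 𝔬.G0 U)
      (fun (y y' : g.Site) => B₂ * ((g.len y)⁻¹ * g.len y') * Real.exp (-(δ * g.dist y y'))))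
    (hEGDv : BlockBd (g := toB6 g R₀ H₀) 𝔬.blkW blk₃ (E ∘ₗ 𝔬.G0 U ∘ₗ 𝔬.Dv U)
      (fun (y y' : g.Site) => B₄ * (g.len y)⁻¹ * Real.exp (-(δ * g.dist y y'))))
    (hEGQs : BlockBd (g := toB6 g R₀ H₀) 𝔬.blkZ blk₃ (E ∘ₗ 𝔬.G0 U ∘ₗ 𝔬.Qstar U)
      (fun (y y' : g.Site) => B₄ * ((g.len y)⁻¹ * g.len y') * Real.exp (-(δ * g.dist y y'))))
    (hI : Identities 𝔬 U) (hq : B₂ * θ * c * c < 1) :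
    BlockBd (g := toB6 g R₀ H₀) 𝔬.blk blk₃ (E ∘ₗ 𝔬.GG U)
      (fun (y y' : g.Site) => constG46 (constKp B₂ B₄ θ c) c * Λ * Real.exp (-((ρ - α * ρ₀) * g.dist y y'))) := by
  -- adapted from `B9Thm313WholeL2G.GG_l2bd_entry3` (Δ_U ↦ E)
  have hc : 0 ≤ c ∨ IsEmpty g.Site := by
    by_cases hne : Nonempty g.Site
    · exact Or.inl (hrow.nonneg hne.some)
    · exact Or.inr (not_nonempty_iff.mp hne)
  rcases hc with hc | hemp
  swap
  · intro y' μ hμ y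
    exact (hemp.false y).elim
  have htri : Triangle254 (toB6 g R₀ H₀) := fun a b c => hG.tri a b c
  have hW1 : ∀ y : g.Site, 0 < (fun _ : g.Site => (1 : ℝ)) y := fun _ => one_pos
  have hWl : ∀ y : g.Site, 0 < (fun y : g.Site => g.len y) y := fun y => hG.lenpos y
  have hWi : ∀ y : g.Site, 0 < (fun y : g.Site => (g.len y)⁻¹) y := fun y => inv_pos.mpr (hG.lenpos y)
  have hfix : 𝔬.G1 U = 𝔬.G0 U + 𝔬.G0 U ∘ₗ (𝔬.Tpi U + 𝔬.T2 U) ∘ₗ 𝔬.G1 U := fix_of_inverses hI.invG0' hI.invG1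
  -- constants
  have hS0 : 0 ≤ B₂ + B₄ := add_nonneg hB₂ hB₄
  have hS₂ : B₂ ≤ B₂ + B₄ := by linarith
  have hS₄ : B₄ ≤ B₂ + B₄ := by linarith
  obtain ⟨hKp0, -⟩ := constP_nonneg_le hθ hc hq hS0 hS0 hS0 le_rfl le_rfl le_rfl
  obtain ⟨hP₂0, hP₂le⟩ := constP_nonneg_le hθ hc hq hB₂ hB₂ hB₂ hS₂ hS₂ hS₂
  obtain ⟨hP₄0, hP₄le⟩ := constP_nonneg_le hθ hc hq hB₄ hB₂ hB₄ hS₄ hS₂ hS₄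
  have hB₄K : B₄ ≤ constP B₂ θ c (B₂ + B₄) (B₂ + B₄) (B₂ + B₄) := by
    have hq1 : 0 ≤ (1 - B₂ * θ * c * c)⁻¹ := inv_nonneg.mpr (by linarith)
    have h0 : 0 ≤ (B₂ + B₄) * (θ * ((B₂ + B₄) * (1 - B₂ * θ * c * c)⁻¹) * c) * c :=
      mul_nonneg (mul_nonneg hS0 (mul_nonneg (mul_nonneg hθ (mul_nonneg hS0 hq1)) hc)) hc
    unfold constP; linarith
  have hKK0 : 0 ≤ constP B₂ θ c (B₂ + B₄) (B₂ + B₄) (B₂ + B₄) * constP B₂ θ c (B₂ + B₄) (B₂ + B₄) (B₂ + B₄) * c :=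
    mul_nonneg (mul_nonneg hKp0 hKp0) hc
  have hKG0 : 0 ≤ constG46 (constKp B₂ B₄ θ c) c := constG46_nonneg hKp0 hc
  -- rates
  have hr₁0 : 0 ≤ ρ + 3 * σ := by linarith
  have hr₁δ : ρ + 3 * σ + 2 * σ ≤ δ := by linarith
  have hr₂0 : 0 ≤ ρ + 2 * σ := by linarith
  have hr₂1 : ρ + 2 * σ ≤ ρ + 3 * σ := by linarith
  have hr₂δ' : ρ + 2 * σ + σ ≤ δ := by linarith
  have hr₂δ : ρ + 2 * σ ≤ δ := by linarith
  have hρr₂ : ρ + 2 * σ ≤ ρ + 2 * σ := le_rfl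
  -- the G₁-entries EG₁, EG₁D, EG₁Q*, G₁ by r1's Neumann bookkeeping, at the rate ρ + 3σ
  have pG := entry_l2w_of_step hG hWl hWl (Eop := E) (Fop := LinearMap.id) (aS := B₂) (aE := B₂) (aEF := B₂) hrow hB₂
    hθ hB₂ hB₂ hB₂ hr₁0 hσ hr₁δ hL hT (by rw [LinearMap.comp_id]; exact hL.l0.mono fun y y' => le_of_eq (by ring))
    (hE3.mono fun y y' => le_of_eq (by ring))
    (by rw [LinearMap.comp_id]; exact hE3.mono fun y y' => le_of_eq (by ring)) hfix hq
  have pGD := entry_l2w_of_step hG hW1 hWl (Eop := E) (Fop := 𝔬.Dv U) (aS := B₄) (aE := B₂) (aEF := B₄) hrow hB₂ hθ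
    hB₄ hB₂ hB₄ hr₁0 hσ hr₁δ hL hT (hLt.gDv.mono fun y y' => le_of_eq (by ring)) (hE3.mono fun y y' => le_of_eq (by ring))
    (hEGDv.mono fun y y' => le_of_eq (by ring)) hfix hq
  have pGQ := entry_l2w_of_step hG hWl hWl (Eop := E) (Fop := 𝔬.Qstar U) (aS := B₄) (aE := B₂) (aEF := B₄) hrow hB₂ hθ
    hB₄ hB₂ hB₄ hr₁0 hσ hr₁δ hL hT (hLt.gQs.mono fun y y' => le_of_eq (by ring)) (hE3.mono fun y y' => le_of_eq (by ring))
    (hEGQs.mono fun y y' => le_of_eq (by ring)) hfix hq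
  have pG1 := entry_l2w_of_step hG hWl hWi (Eop := LinearMap.id) (Fop := LinearMap.id) (aS := B₂) (aE := B₂) (aEF := B₂)
    hrow hB₂ hθ hB₂ hB₂ hB₂ hr₁0 hσ hr₁δ hL hT
    (by rw [LinearMap.comp_id]; exact hL.l0.mono fun y y' => le_of_eq (by ring))
    (by rw [LinearMap.id_comp]; exact hL.l0.mono fun y y' => le_of_eq (by rw [inv_inv]; ring))
    (by rw [LinearMap.id_comp, LinearMap.comp_id]; exact hL.l0.mono fun y y' => le_of_eq (by rw [inv_inv]; ring)) hfix hq
  rw [LinearMap.id_comp] at pG1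
  -- the letters RD*G₁, C₁, Q in the block-L² classes
  have pRG : HasMaj (l2w (toB6 g R₀ H₀) 𝔬.blk (fun y : g.Site => g.len y) fun y => (hWl y).le)
      (l2w (toB6 g R₀ H₀) 𝔬.blkW (fun _ : g.Site => (1 : ℝ)) fun y => (hW1 y).le)
      (𝔬.R U ∘ₗ 𝔬.Dvstar U ∘ₗ 𝔬.G1 U ∘ₗ LinearMap.id) (fun y y' => B₄ * Real.exp (-(δ * g.dist y y'))) :=
    hasMaj_l2w_of_blockBd_ratio (g := toB6 g R₀ H₀) hWl hW1 (hLt.rgdI.mono fun y y' => le_of_eq (by ring))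
  have pC : HasMaj (l2w (toB6 g R₀ H₀) 𝔬.blkZ (fun y : g.Site => (g.len y)⁻¹) fun y => (hWi y).le)
      (l2w (toB6 g R₀ H₀) 𝔬.blkZ (fun y : g.Site => g.len y) fun y => (hWl y).le)
      (𝔬.C1 U) (fun y y' => B₄ * Real.exp (-(δ * g.dist y y'))) :=
    hasMaj_l2w_of_blockBd_ratio (g := toB6 g R₀ H₀) hWi hWl (hLt.c1.mono fun y y' => le_of_eq (by ring))
  have pQ : HasMaj (l2w (toB6 g R₀ H₀) 𝔬.blk (fun y : g.Site => (g.len y)⁻¹) fun y => (hWi y).le)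
      (l2w (toB6 g R₀ H₀) 𝔬.blkZ (fun y : g.Site => (g.len y)⁻¹) fun y => (hWi y).le)
      (𝔬.Q U) (fun y y' => B₄ * Real.exp (-(δ * g.dist y y'))) :=
    hasMaj_l2w_of_blockBd_ratio (g := toB6 g R₀ H₀) hWi hWi (hLt.q.mono fun y y' => le_of_eq (by rw [inv_inv]; ring))
  -- QG₁ at the rate ρ + 2σ
  have pQG := hasMaj_comp_exp htri hG.dnn hrow hB₄ hP₂0 hr₂0 hr₂1 hr₂δ' pQ pG1
  simp only [l2w_κ, one_mul] at pQG
  -- everything at (K_p, ρ + 2σ), the composite at K_p²c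
  have uG := hasMaj_up hG hP₂0 hP₂le hr₂1 pG
  have uGD := hasMaj_up hG hP₄0 hP₄le hr₂1 pGD
  have uRG := hasMaj_up hG hB₄ hB₄K hr₂δ pRG
  have uGQ := hasMaj_up hG hP₄0 hP₄le hr₂1 pGQ
  have uC := hasMaj_up hG hB₄ hB₄K hr₂δ pC
  have uQG := hasMaj_up hG (mul_nonneg (mul_nonneg hB₄ hP₂0) hc)
    (mul_le_mul_of_nonneg_right (mul_le_mul hB₄K hP₂le hP₂0 hKp0) hc) hρr₂ pQG
  -- (3.153) composed in the block-L² classes, then unweighted and transferred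
  have hfr := hasMaj_frakG_classes htri hG.dnn hrow hKp0 hKp0 hKp0 hKp0 hKp0 hKK0 hρ hσ hρr₂ uG uGD uRG uGQ uC uQG
  have hGG := hfr.congr (T' := E ∘ₗ 𝔬.GG U) fun μ => by rw [E_GG_eq hI E]
  have hbd := blockBd_of_hasMaj_l2w hGG hWl
  have h' : BlockBd (g := toB6 g R₀ H₀) 𝔬.blk blk₃ (E ∘ₗ 𝔬.GG U)
      (fun (y y' : g.Site) => constG46 (constKp B₂ B₄ θ c) c * (g.len y' ^ (1 : ℝ) * (g.len y ^ (1 : ℝ))⁻¹) *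
        Real.exp (-(ρ * g.dist y y'))) :=
    hbd.mono fun y y' => le_of_eq (by
      simp only [l2w_κ, one_mul, toB6_dist, constG46, constKp, Real.rpow_one, div_eq_mul_inv]; ring)
  exact blockBd_transfer (C := fun _ _ => constG46 (constKp B₂ B₄ θ c) c) (fun _ _ => hKG0)
    (fun z => Real.rpow_pos_of_pos (hG.lenpos z) 1) hST h'

/-- ★ **A SECOND-ORDER L² LINE OF 𝔊 = 𝔓G₁ WITH A GENERIC RIGHT LETTER** F : 𝔩(X₀) → 𝔩(X) (∇\*_ν∇\*_μ, Δ_U, …): (3.153) with the right factor F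
(`GG_comp_eq`), the G₁-entries G₁F, G₁D, G₁Q* from Theorem 3.3 for G₀ and the step (`entry_l2w_of_step`; the F-specific bounds of G₀∘F (`hF5`, ratio
class) and RD*G₁F (`hrgdF`) as explicit hypotheses of printed shape), the letters C₁, Q, composed by `hasMaj_frakG_classes` in the block-L² classes
(Lʲη)⁻¹ → (Lʲη)⁻¹, then the scale transfer (2.60) at the weight (Lʲη)⁻¹ (constant Λ′): block bound `constG46 (constKp B₂ B₄ θ c) c`·Λ′·e^{−(ρ−αρ₀)d}
between `blk₀` and `blk`; provisos ρ + 5σ ≦ δ, B₂θc² < 1 (the abstraction of `GG_l2bd_entry5` from Δ_U to any F).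
[cite: Balaban1985BackgroundPropagators, Thm 3.13 p.426 + (3.153) p.426 + (3.46) p.398 + p.398 (remark after (3.47)); Balaban1984PropagatorsII, Lemma 2.1 (2.60)–(2.61) p.234] -/
theorem GG_l2bd_right (hG : GeoOK g) {𝔬 : Ops g B X Y Z W} {Lap : B.Cfg → Module.End ℝ (X → ℝ)} {U : B.Cfg}
    {X₀ : Type} [Fintype X₀] {blk₀ : X₀ → g.Site} {F : (X₀ → ℝ) →ₗ[ℝ] (X → ℝ)}
    {B₂ B₄ θ δ ρ ρ₀ α Λ σ c : ℝ} (hrow : RowSum (toB6 g R₀ H₀) σ c) (hB₂ : 0 ≤ B₂) (hB₄ : 0 ≤ B₄) (hθ : 0 ≤ θ) (hρ : 0 ≤ ρ)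
    (hσ : 0 ≤ σ) (hρδ : ρ + 5 * σ ≤ δ) (hST : ScaleTransfer g ρ₀ α Λ (fun y => g.len y ^ (-1 : ℝ)))
    (hL : Thm33G0L2 𝔬 Lap R₀ H₀ B₂ δ U)
    (hT : BlockBd (g := toB6 g R₀ H₀) 𝔬.blk 𝔬.blk (𝔬.Tpi U + 𝔬.T2 U)
      (fun (y y' : g.Site) => θ * (g.len y)⁻¹ * (g.len y')⁻¹ * Real.exp (-(δ * g.dist y y'))))
    (hLt : Letters313L2 𝔬 Lap R₀ H₀ B₄ δ U)
    (hF5 : BlockBd (g := toB6 g R₀ H₀) blk₀ 𝔬.blk (𝔬.G0 U ∘ₗ F)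
      (fun (y y' : g.Site) => B₂ * (g.len y * (g.len y')⁻¹) * Real.exp (-(δ * g.dist y y'))))
    (hrgdF : BlockBd (g := toB6 g R₀ H₀) blk₀ 𝔬.blkW (𝔬.R U ∘ₗ 𝔬.Dvstar U ∘ₗ 𝔬.G1 U ∘ₗ F)
      (fun (y y' : g.Site) => B₄ * (g.len y')⁻¹ * Real.exp (-(δ * g.dist y y'))))
    (hI : Identities 𝔬 U) (hq : B₂ * θ * c * c < 1) :
    BlockBd (g := toB6 g R₀ H₀) blk₀ 𝔬.blk (𝔬.GG U ∘ₗ F)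
      (fun (y y' : g.Site) => constG46 (constKp B₂ B₄ θ c) c * Λ * Real.exp (-((ρ - α * ρ₀) * g.dist y y'))) := by
  -- adapted from `B9Thm313WholeL2G.GG_l2bd_entry5` (Δ_U ↦ F)
  have hc : 0 ≤ c ∨ IsEmpty g.Site := by
    by_cases hne : Nonempty g.Site
    · exact Or.inl (hrow.nonneg hne.some)
    · exact Or.inr (not_nonempty_iff.mp hne)
  rcases hc with hc | hemp
  swap
  · intro y' μ hμ y
    exact (hemp.false y).elim
  have htri : Triangle254 (toB6 g R₀ H₀) := fun a b c => hG.tri a b c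
  have hW1 : ∀ y : g.Site, 0 < (fun _ : g.Site => (1 : ℝ)) y := fun _ => one_pos
  have hWl : ∀ y : g.Site, 0 < (fun y : g.Site => g.len y) y := fun y => hG.lenpos y
  have hWi : ∀ y : g.Site, 0 < (fun y : g.Site => (g.len y)⁻¹) y := fun y => inv_pos.mpr (hG.lenpos y)
  have hfix : 𝔬.G1 U = 𝔬.G0 U + 𝔬.G0 U ∘ₗ (𝔬.Tpi U + 𝔬.T2 U) ∘ₗ 𝔬.G1 U := fix_of_inverses hI.invG0' hI.invG1
  -- constants
  have hS0 : 0 ≤ B₂ + B₄ := add_nonneg hB₂ hB₄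
  have hS₂ : B₂ ≤ B₂ + B₄ := by linarith
  have hS₄ : B₄ ≤ B₂ + B₄ := by linarith
  obtain ⟨hKp0, -⟩ := constP_nonneg_le hθ hc hq hS0 hS0 hS0 le_rfl le_rfl le_rfl
  obtain ⟨hP₂0, hP₂le⟩ := constP_nonneg_le hθ hc hq hB₂ hB₂ hB₂ hS₂ hS₂ hS₂
  obtain ⟨hP₄0, hP₄le⟩ := constP_nonneg_le hθ hc hq hB₄ hB₂ hB₄ hS₄ hS₂ hS₄
  have hB₄K : B₄ ≤ constP B₂ θ c (B₂ + B₄) (B₂ + B₄) (B₂ + B₄) := by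
    have hq1 : 0 ≤ (1 - B₂ * θ * c * c)⁻¹ := inv_nonneg.mpr (by linarith)
    have h0 : 0 ≤ (B₂ + B₄) * (θ * ((B₂ + B₄) * (1 - B₂ * θ * c * c)⁻¹) * c) * c :=
      mul_nonneg (mul_nonneg hS0 (mul_nonneg (mul_nonneg hθ (mul_nonneg hS0 hq1)) hc)) hc
    unfold constP; linarith
  have hKK0 : 0 ≤ constP B₂ θ c (B₂ + B₄) (B₂ + B₄) (B₂ + B₄) * constP B₂ θ c (B₂ + B₄) (B₂ + B₄) (B₂ + B₄) * c :=
    mul_nonneg (mul_nonneg hKp0 hKp0) hc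
  have hKG0 : 0 ≤ constG46 (constKp B₂ B₄ θ c) c := constG46_nonneg hKp0 hc
  -- rates
  have hr₁0 : 0 ≤ ρ + 3 * σ := by linarith
  have hr₁δ : ρ + 3 * σ + 2 * σ ≤ δ := by linarith
  have hr₂0 : 0 ≤ ρ + 2 * σ := by linarith
  have hr₂1 : ρ + 2 * σ ≤ ρ + 3 * σ := by linarith
  have hr₂δ' : ρ + 2 * σ + σ ≤ δ := by linarith
  have hr₂δ : ρ + 2 * σ ≤ δ := by linarith
  have hρr₂ : ρ + 2 * σ ≤ ρ + 2 * σ := le_rfl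
  -- the G₁-entries G₁F, G₁D, G₁Q* by r1's Neumann bookkeeping, at the rate ρ + 3σ
  have pG := entry_l2w_of_step hG hWi hWi (Eop := LinearMap.id) (Fop := F) (aS := B₂) (aE := B₂) (aEF := B₂) hrow hB₂
    hθ hB₂ hB₂ hB₂ hr₁0 hσ hr₁δ hL hT (hF5.mono fun y y' => le_of_eq (by ring))
    (by rw [LinearMap.id_comp]; exact hL.l0.mono fun y y' => le_of_eq (by rw [inv_inv]; ring))
    (by rw [LinearMap.id_comp]; exact hF5.mono fun y y' => le_of_eq (by rw [inv_inv]; ring)) hfix hq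
  rw [LinearMap.id_comp] at pG
  have pGD := entry_l2w_of_step hG hW1 hWi (Eop := LinearMap.id) (Fop := 𝔬.Dv U) (aS := B₄) (aE := B₂) (aEF := B₄) hrow
    hB₂ hθ hB₄ hB₂ hB₄ hr₁0 hσ hr₁δ hL hT (hLt.gDv.mono fun y y' => le_of_eq (by ring))
    (by rw [LinearMap.id_comp]; exact hL.l0.mono fun y y' => le_of_eq (by rw [inv_inv]; ring))
    (by rw [LinearMap.id_comp]; exact hLt.gDv.mono fun y y' => le_of_eq (by rw [inv_inv]; ring)) hfix hq
  rw [LinearMap.id_comp] at pGD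
  have pGQ := entry_l2w_of_step hG hWl hWi (Eop := LinearMap.id) (Fop := 𝔬.Qstar U) (aS := B₄) (aE := B₂) (aEF := B₄) hrow
    hB₂ hθ hB₄ hB₂ hB₄ hr₁0 hσ hr₁δ hL hT (hLt.gQs.mono fun y y' => le_of_eq (by ring))
    (by rw [LinearMap.id_comp]; exact hL.l0.mono fun y y' => le_of_eq (by rw [inv_inv]; ring))
    (by rw [LinearMap.id_comp]; exact hLt.gQs.mono fun y y' => le_of_eq (by rw [inv_inv]; ring)) hfix hq
  rw [LinearMap.id_comp] at pGQ
  -- the letters RD*G₁F, C₁, Q in the block-L² classes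
  have pRG : HasMaj (l2w (toB6 g R₀ H₀) blk₀ (fun y : g.Site => (g.len y)⁻¹) fun y => (hWi y).le)
      (l2w (toB6 g R₀ H₀) 𝔬.blkW (fun _ : g.Site => (1 : ℝ)) fun y => (hW1 y).le)
      (𝔬.R U ∘ₗ 𝔬.Dvstar U ∘ₗ 𝔬.G1 U ∘ₗ F) (fun y y' => B₄ * Real.exp (-(δ * g.dist y y'))) :=
    hasMaj_l2w_of_blockBd_ratio (g := toB6 g R₀ H₀) hWi hW1 (hrgdF.mono fun y y' => le_of_eq (by ring))
  have pC : HasMaj (l2w (toB6 g R₀ H₀) 𝔬.blkZ (fun y : g.Site => (g.len y)⁻¹) fun y => (hWi y).le)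
      (l2w (toB6 g R₀ H₀) 𝔬.blkZ (fun y : g.Site => g.len y) fun y => (hWl y).le)
      (𝔬.C1 U) (fun y y' => B₄ * Real.exp (-(δ * g.dist y y'))) :=
    hasMaj_l2w_of_blockBd_ratio (g := toB6 g R₀ H₀) hWi hWl (hLt.c1.mono fun y y' => le_of_eq (by ring))
  have pQ : HasMaj (l2w (toB6 g R₀ H₀) 𝔬.blk (fun y : g.Site => (g.len y)⁻¹) fun y => (hWi y).le)
      (l2w (toB6 g R₀ H₀) 𝔬.blkZ (fun y : g.Site => (g.len y)⁻¹) fun y => (hWi y).le)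
      (𝔬.Q U) (fun y y' => B₄ * Real.exp (-(δ * g.dist y y'))) :=
    hasMaj_l2w_of_blockBd_ratio (g := toB6 g R₀ H₀) hWi hWi (hLt.q.mono fun y y' => le_of_eq (by rw [inv_inv]; ring))
  -- QG₁F at the rate ρ + 2σ
  have pQG := hasMaj_comp_exp htri hG.dnn hrow hB₄ hP₂0 hr₂0 hr₂1 hr₂δ' pQ pG
  simp only [l2w_κ, one_mul] at pQG
  -- everything at (K_p, ρ + 2σ), the composite at K_p²c
  have uG := hasMaj_up hG hP₂0 hP₂le hr₂1 pG
  have uGD := hasMaj_up hG hP₄0 hP₄le hr₂1 pGD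
  have uRG := hasMaj_up hG hB₄ hB₄K hr₂δ pRG
  have uGQ := hasMaj_up hG hP₄0 hP₄le hr₂1 pGQ
  have uC := hasMaj_up hG hB₄ hB₄K hr₂δ pC
  have uQG := hasMaj_up hG (mul_nonneg (mul_nonneg hB₄ hP₂0) hc)
    (mul_le_mul_of_nonneg_right (mul_le_mul hB₄K hP₂le hP₂0 hKp0) hc) hρr₂ pQG
  -- (3.153) composed in the block-L² classes, then unweighted and transferred
  have hfr := hasMaj_frakG_classes htri hG.dnn hrow hKp0 hKp0 hKp0 hKp0 hKp0 hKK0 hρ hσ hρr₂ uG uGD uRG uGQ uC uQG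
  have hGG := hfr.congr (T' := 𝔬.GG U ∘ₗ F) fun μ => by rw [GG_comp_eq hI F]
  have hbd := blockBd_of_hasMaj_l2w hGG hWi
  have h' : BlockBd (g := toB6 g R₀ H₀) blk₀ 𝔬.blk (𝔬.GG U ∘ₗ F)
      (fun (y y' : g.Site) => constG46 (constKp B₂ B₄ θ c) c * (g.len y' ^ (-1 : ℝ) * (g.len y ^ (-1 : ℝ))⁻¹) *
        Real.exp (-(ρ * g.dist y y'))) :=
    hbd.mono fun y y' => le_of_eq (by
      simp only [l2w_κ, one_mul, toB6_dist, constG46, constKp, Real.rpow_neg_one, div_eq_mul_inv]; ring)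
  exact blockBd_transfer (C := fun _ _ => constG46 (constKp B₂ B₄ θ c) c) (fun _ _ => hKG0)
    (fun z => Real.rpow_pos_of_pos (hG.lenpos z) (-1)) hST h'

/-! ## §3 The direction-pair families of 𝔊 packaged by `familyOp` -/

/-- ★ **(3.46)₃ FOR 𝔊 AS THE PACKAGED PAIR FAMILY ∇_{U,ν}∇_{U,μ}𝔊** — one model X → X × (P × P) with block map `blk ∘ Prod.fst`, block bound
√|P × P|·`constG46 (constKp B₂ B₄ θ c) c`·Λ·e^{−(ρ−αρ₀)d(y,y′)}: `GG_l2bd_left` for every pair from Theorem 3.3's pair-indexed L² bounds for G₀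
(`Thm33G0L2P.l3 q`) and the pair letters (`Letters313L2P.ddGDv q`, `ddGQs q`), then `blockBd_familyOp`.
[cite: Balaban1985BackgroundPropagators, Thm 3.13 p.426 + (3.153) p.426 + (3.46) p.398 + (3.39) p.397; Balaban1984PropagatorsII, Lemma 2.1 (2.60)–(2.61) p.234] -/
theorem GG_l2bd_family3 [Fintype P] (hG : GeoOK g) {𝔬 : Ops g B X Y Z W} {Dd Dds : B.Cfg → P → Module.End ℝ (X → ℝ)} {U : B.Cfg}
    {B₂ B₄ θ δ ρ ρ₀ α Λ σ c : ℝ} (hrow : RowSum (toB6 g R₀ H₀) σ c) (hB₂ : 0 ≤ B₂) (hB₄ : 0 ≤ B₄) (hθ : 0 ≤ θ) (hρ : 0 ≤ ρ)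
    (hσ : 0 ≤ σ) (hρδ : ρ + 5 * σ ≤ δ) (hΛ : 0 ≤ Λ) (hST : ScaleTransfer g ρ₀ α Λ (fun y => g.len y ^ (1 : ℝ)))
    (hL : Thm33G0L2P 𝔬 Dd Dds R₀ H₀ B₂ δ U)
    (hT : BlockBd (g := toB6 g R₀ H₀) 𝔬.blk 𝔬.blk (𝔬.Tpi U + 𝔬.T2 U)
      (fun (y y' : g.Site) => θ * (g.len y)⁻¹ * (g.len y')⁻¹ * Real.exp (-(δ * g.dist y y'))))
    (hLt : Letters313L2P 𝔬 Dd Dds R₀ H₀ B₄ δ U) (hI : Identities 𝔬 U) (hq : B₂ * θ * c * c < 1) :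
    BlockBd (g := toB6 g R₀ H₀) 𝔬.blk (𝔬.blk ∘ Prod.fst) (familyOp (fun q : P × P => (Dd U q.1 ∘ₗ Dd U q.2) ∘ₗ 𝔬.GG U))
      (fun (y y' : g.Site) => Real.sqrt (Fintype.card (P × P)) * (constG46 (constKp B₂ B₄ θ c) c * Λ *
        Real.exp (-((ρ - α * ρ₀) * g.dist y y')))) := by
  have hc : 0 ≤ c ∨ IsEmpty g.Site := by
    by_cases hne : Nonempty g.Site
    · exact Or.inl (hrow.nonneg hne.some)
    · exact Or.inr (not_nonempty_iff.mp hne)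
  rcases hc with hc | hemp
  swap
  · intro y' μ hμ y
    exact (hemp.false y).elim
  have hS0 : 0 ≤ B₂ + B₄ := add_nonneg hB₂ hB₄
  obtain ⟨hKp0, -⟩ := constP_nonneg_le hθ hc hq hS0 hS0 hS0 le_rfl le_rfl le_rfl
  have hKG0 : 0 ≤ constG46 (constKp B₂ B₄ θ c) c := constG46_nonneg hKp0 hc
  exact blockBd_familyOp (R := R₀) (H := H₀) 𝔬.blk 𝔬.blk
    (fun a b => mul_nonneg (mul_nonneg hKG0 hΛ) (Real.exp_nonneg _))
    fun q => GG_l2bd_left hG hrow hB₂ hB₄ hθ hρ hσ hρδ hST (Thm33G0L2P.toLap hB₂ hG.lenle hL) hT (Letters313L2P.toLap hB₄ hG.lenle hLt) (hL.l3 q)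
      (hLt.ddGDv q) (hLt.ddGQs q) hI hq

/-- ★ **(3.46)₅ FOR 𝔊 AS THE PACKAGED PAIR FAMILY 𝔊∇\*_{U,ν}∇\*_{U,μ}** — one model X → X × (P × P) with block map `blk ∘ Prod.fst`, block bound
√|P × P|·`constG46 (constKp B₂ B₄ θ c) c`·Λ′·e^{−(ρ−αρ₀)d(y,y′)}: `GG_l2bd_right` for every pair from `Thm33G0L2P.l5 q` and the pair letter
`Letters313L2P.rgdDds q`, then `blockBd_familyOp`.
[cite: Balaban1985BackgroundPropagators, Thm 3.13 p.426 + (3.153) p.426 + (3.46) p.398 + (3.39) p.397; Balaban1984PropagatorsII, Lemma 2.1 (2.60)–(2.61) p.234] -/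
theorem GG_l2bd_family5 [Fintype P] (hG : GeoOK g) {𝔬 : Ops g B X Y Z W} {Dd Dds : B.Cfg → P → Module.End ℝ (X → ℝ)} {U : B.Cfg}
    {B₂ B₄ θ δ ρ ρ₀ α Λ σ c : ℝ} (hrow : RowSum (toB6 g R₀ H₀) σ c) (hB₂ : 0 ≤ B₂) (hB₄ : 0 ≤ B₄) (hθ : 0 ≤ θ) (hρ : 0 ≤ ρ)
    (hσ : 0 ≤ σ) (hρδ : ρ + 5 * σ ≤ δ) (hΛ : 0 ≤ Λ) (hST : ScaleTransfer g ρ₀ α Λ (fun y => g.len y ^ (-1 : ℝ)))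
    (hL : Thm33G0L2P 𝔬 Dd Dds R₀ H₀ B₂ δ U)
    (hT : BlockBd (g := toB6 g R₀ H₀) 𝔬.blk 𝔬.blk (𝔬.Tpi U + 𝔬.T2 U)
      (fun (y y' : g.Site) => θ * (g.len y)⁻¹ * (g.len y')⁻¹ * Real.exp (-(δ * g.dist y y'))))
    (hLt : Letters313L2P 𝔬 Dd Dds R₀ H₀ B₄ δ U) (hI : Identities 𝔬 U) (hq : B₂ * θ * c * c < 1) :
    BlockBd (g := toB6 g R₀ H₀) 𝔬.blk (𝔬.blk ∘ Prod.fst) (familyOp (fun q : P × P => 𝔬.GG U ∘ₗ (Dds U q.1 ∘ₗ Dds U q.2)))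
      (fun (y y' : g.Site) => Real.sqrt (Fintype.card (P × P)) * (constG46 (constKp B₂ B₄ θ c) c * Λ *
        Real.exp (-((ρ - α * ρ₀) * g.dist y y')))) := by
  have hc : 0 ≤ c ∨ IsEmpty g.Site := by
    by_cases hne : Nonempty g.Site
    · exact Or.inl (hrow.nonneg hne.some)
    · exact Or.inr (not_nonempty_iff.mp hne)
  rcases hc with hc | hemp
  swap
  · intro y' μ hμ y
    exact (hemp.false y).elim
  have hS0 : 0 ≤ B₂ + B₄ := add_nonneg hB₂ hB₄
  obtain ⟨hKp0, -⟩ := constP_nonneg_le hθ hc hq hS0 hS0 hS0 le_rfl le_rfl le_rfl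
  have hKG0 : 0 ≤ constG46 (constKp B₂ B₄ θ c) c := constG46_nonneg hKp0 hc
  exact blockBd_familyOp (R := R₀) (H := H₀) 𝔬.blk 𝔬.blk
    (fun a b => mul_nonneg (mul_nonneg hKG0 hΛ) (Real.exp_nonneg _))
    fun q => GG_l2bd_right hG hrow hB₂ hB₄ hθ hρ hσ hρδ hST (Thm33G0L2P.toLap hB₂ hG.lenle hL) hT (Letters313L2P.toLap hB₄ hG.lenle hLt) (hL.l5 q)
      (hLt.rgdDds q) hI hq

end L2GP

end

end Literature.MathematicalPhysics.QuantumFieldTheory.Balaban1983to89.B9Thm313WholeL2GP
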